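import Summits.QuantumAdvantage.AdviceFreeQNC0.NPGamma37WalkLocal
import Summits.QuantumAdvantage.AdviceFreeQNC0.PredHard
import HarnessLib

/-!
# Cell qa-qnc0 — (NP-W) corollary: p1's (J2⁻) `PerOutputGatesHardPoly` AT THE RING CHARGE, in its literal quantifier shape

Planner qa-qnc0-p2 gen 34 (INBOX P2-34j/k, memo HOME/qa-qnc0-p2/ROUND-34P2.md §4.10).  From
`ringHardWalkLocalLinForms3_explicit` (e = 7, n₀ = 199, explicit window condition) by polylog absorption
(the tree's `DWalk.const_mul_logPow_le'`): for every `r, C` and all large `n`, every walk strategy whose output `g` is ANY function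
of `r` DENSE 𝔽₃-linear forms `ℓ g i` of the letters `x(u)` (private to `g`) and of the walk bits in the window
of radius `(log₂ n)^C` around `g` wins the ring game at charge `n + 2` on at most `(1 − n^{-8})·2ⁿ` walks.
This is `BlockFibre37.PerOutputGatesHardPoly` (p1, Join37) with the charge specialised to `c = n + 2`
(the charge of the transported ring relation, `rel_iff_ringWinU`); the forms are written as the body of
`BlockFibre37.gateSum` so that the bridge is `rfl`.
-/

noncomputable section

namespace Summit.QuantumAdvantage.AdviceFreeQNC0.NPGamma37Proof

open Finset
open Classical

section WalkLocalPoly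

open Literature.Computability.QuantumComplexity Literature.Computability.QuantumComplexity.RingHLF
open Literature.Computability.MetaComplexity
open AffBells23 AffBells26

/-- polylog absorption for the window condition of `ringHardWalkLocalLinForms3_explicit`
(via the tree's `DWalk.const_mul_logPow_le'`). -/
theorem window_room (C : ℕ) : ∃ n₀ : ℕ, ∀ n ≥ n₀,
    8 * Nat.log 2 (n + 1) * (2 * (Nat.log 2 n) ^ C + 3) + 4 ≤ n := by
  obtain ⟨n₁, hn₁⟩ := DWalk.const_mul_logPow_le' 84 (C + 1)
  refine ⟨max n₁ 2, fun n hn => ?_⟩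
  have hroom : 84 * (Nat.log 2 n) ^ (C + 1) ≤ n := hn₁ n (le_trans (le_max_left _ _) hn)
  have hn2 : 2 ≤ n := le_trans (le_max_right _ _) hn
  set k := Nat.log 2 n with hk
  have hk1 : 1 ≤ k := Nat.le_log_of_pow_le one_lt_two (by simpa using hn2)
  -- `log₂ (n+1) ≤ k + 1 ≤ 2k`
  have hlt : n < 2 ^ (k + 1) := Nat.lt_pow_succ_log_self one_lt_two n
  have hL : Nat.log 2 (n + 1) ≤ k + 1 := by
    have h : n + 1 < 2 ^ (k + 2) := by
      have : 2 ^ (k + 1) < 2 ^ (k + 2) := Nat.pow_lt_pow_right (by norm_num) (by omega)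
      omega
    have := Nat.log_lt_of_lt_pow (by omega) h
    omega
  have hkC : k ^ C * k = k ^ (C + 1) := (pow_succ k C).symm
  have hkC1 : 1 ≤ k ^ C := Nat.one_le_pow _ _ hk1
  -- `8 (k+1) (2 k^C + 3) + 4 ≤ 8 · 2k · 5 k^C + 4 ≤ 84 k^{C+1}`
  have hA : 8 * Nat.log 2 (n + 1) * (2 * k ^ C + 3) ≤ 8 * (2 * k) * (5 * k ^ C) := by
    have h5 : 2 * k ^ C + 3 ≤ 5 * k ^ C := by omega
    calc 8 * Nat.log 2 (n + 1) * (2 * k ^ C + 3) ≤ 8 * (2 * k) * (2 * k ^ C + 3) := by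
          apply Nat.mul_le_mul_right; apply Nat.mul_le_mul_left; omega
      _ ≤ 8 * (2 * k) * (5 * k ^ C) := Nat.mul_le_mul_left _ h5
  have hB : 8 * (2 * k) * (5 * k ^ C) = 80 * k ^ (C + 1) := by rw [← hkC]; ring
  have hC4 : 4 ≤ 4 * k ^ (C + 1) := by
    have : 1 ≤ k ^ (C + 1) := Nat.one_le_pow _ _ hk1
    omega
  omega

/-- `(1 − (n+1)^{-7}) ≤ (1 − n^{-8})` for `n ≥ 128`. -/
theorem lossShift {n : ℕ} (hn : 128 ≤ n) :
    (1 - 1 / ((n : ℝ) + 1) ^ 7) * (2 : ℝ) ^ n ≤ (1 - 1 / (n : ℝ) ^ 8) * (2 : ℝ) ^ n := by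
  have hnat : (n + 1) ^ 7 ≤ n ^ 8 := by
    calc (n + 1) ^ 7 ≤ (2 * n) ^ 7 := Nat.pow_le_pow_left (by omega) 7
      _ = 128 * n ^ 7 := by ring
      _ ≤ n * n ^ 7 := Nat.mul_le_mul_right _ hn
      _ = n ^ 8 := by ring
  have hpos : (0 : ℝ) < ((n : ℝ) + 1) ^ 7 := by positivity
  have hle : ((n : ℝ) + 1) ^ 7 ≤ (n : ℝ) ^ 8 := by exact_mod_cast hnat
  have h : 1 / (n : ℝ) ^ 8 ≤ 1 / ((n : ℝ) + 1) ^ 7 := one_div_le_one_div_of_le hpos hle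
  have h2 : (0 : ℝ) ≤ (2 : ℝ) ^ n := by positivity
  nlinarith

/-- **(J2⁻)_ring** — `BlockFibre37.PerOutputGatesHardPoly` (p1, Join37) with the charge specialised to the
ring charge `c := n + 2`; the forms are the body of `BlockFibre37.gateSum (ℓ g i) u`. -/
def PerOutputGatesHardPolyRing : Prop :=
  ∃ e : ℕ, ∀ r C : ℕ, ∃ n₀ : ℕ, ∀ n ≥ n₀,
    ∀ (ℓ : Fin (n + 1) → Fin r → Fin (n + 1) → ZMod 3)
      (F : Fin (n + 1) → (Fin r → ZMod 3) → (Fin n → Bool) → Bool),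
      (∀ t, WindowLocal ((Nat.log 2 n) ^ C) (fun g u => F g t u)) →
      ((univ.filter fun u : Fin n → Bool =>
          ringWinU (n + 2) (fun g u => F g
            (fun i => ∑ j : Fin (n + 1), if xOfU u j = true then ℓ g i j else 0) u) u = true).card : ℝ)
        ≤ (1 - 1 / (n : ℝ) ^ e) * (2 : ℝ) ^ n

/-- ★ **(J2⁻) at the ring charge.**  `BlockFibre37.PerOutputGatesHardPoly` with `c := n + 2`:
for every `r, C` and all large `n`, every output `g` = an ARBITRARY function of `r` DENSE 𝔽₃-linear
forms private to `g` and of the walk bits `u_i`, `g − (log₂ n)^C ≤ i < g + (log₂ n)^C`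
(`WindowLocal`), wins the ring game at charge `n + 2` on at most `(1 − n^{-8})·2ⁿ` walks. -/
theorem perOutputGatesHardPoly_ring :
    ∃ e : ℕ, ∀ r C : ℕ, ∃ n₀ : ℕ, ∀ n ≥ n₀,
      ∀ (ℓ : Fin (n + 1) → Fin r → Fin (n + 1) → ZMod 3)
        (F : Fin (n + 1) → (Fin r → ZMod 3) → (Fin n → Bool) → Bool),
        (∀ t, WindowLocal ((Nat.log 2 n) ^ C) (fun g u => F g t u)) →
        ((univ.filter fun u : Fin n → Bool =>
            ringWinU (n + 2) (fun g u => F g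
              (fun i => ∑ j : Fin (n + 1), if xOfU u j = true then ℓ g i j else 0) u) u = true).card : ℝ)
          ≤ (1 - 1 / (n : ℝ) ^ e) * (2 : ℝ) ^ n := by
  refine ⟨8, fun r C => ?_⟩
  obtain ⟨n₁, hn₁⟩ := window_room C
  refine ⟨max n₁ (max 199 (2 ^ (r + 1))), fun n hn ℓ F hloc => ?_⟩
  have hn₁n : n₁ ≤ n := le_trans (le_max_left _ _) hn
  have hn199 : 199 ≤ n := le_trans (le_trans (le_max_left _ _) (le_max_right _ _)) hn
  have hnr : 2 ^ (r + 1) ≤ n := le_trans (le_trans (le_max_right _ _) (le_max_right _ _)) hn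
  have hR : r < Nat.log 2 (n + 1) := by
    have h1 : r + 1 ≤ Nat.log 2 n := Nat.le_log_of_pow_le one_lt_two hnr
    have h2 : Nat.log 2 n ≤ Nat.log 2 (n + 1) := Nat.log_mono_right (by omega)
    omega
  have hmain := ringHardWalkLocalLinForms3_explicit n hn199 ((Nat.log 2 n) ^ C) (hn₁ n hn₁n)
    r hR ℓ F hloc
  exact le_trans hmain (lossShift (by omega))

/-- ★ (J2⁻) at the ring charge, packaged. -/
theorem perOutputGatesHardPolyRing : PerOutputGatesHardPolyRing := perOutputGatesHardPoly_ring

end WalkLocalPoly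

end Summit.QuantumAdvantage.AdviceFreeQNC0.NPGamma37Proof
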